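import Mathlib.Analysis.SpecialFunctions.Log.NegMulLog
import HarnessLib

/-!
# Kernel-checkable certificates for linear inequalities between logarithms and entropies of rationals

Topic `Literature/Computability/AlgebraicComplexity`.  The numerical half of every laser-method bound on
`ω` (Coppersmith–Winograd 1990 §8; Le Gall 2014 Table 2; Vassilevska Williams–Xu–Xu–Zhou 2024 §8;
Alman–Duan–Vassilevska Williams–Xu–Xu–Zhou 2025 §7) is a finite list of inequalities
`∑_j c_j · v_j ≥ b` whose atoms `v_j` are natural logarithms `ln(a/d)` of positive rationals and
entropy sums `∑_i −p_i ln p_i` of rational vectors (Shannon entropies, the penalty terms `P_α` through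
their Gibbs/Lagrange dual bound, the matrix sizes).  For VXXZ 2024 (`ω ≤ 2.371552`, 6759 parameters,
margin `1.9·10⁻⁷`) there are thousands of atoms, each needed to `~10⁻¹²` — out of reach of one
`norm_num` call per atom.  This file provides a REFLECTIVE checker instead, with its soundness
theorem; everything stated is proved, there are no named facts, and nothing is specific to matrix
multiplication.

* **Data.** A table `T : LogTable` of integer enclosures `lo_k ≤ 2^L ln q_k ≤ hi_k` of the logarithms
  of a few small primes (soundness predicate `LogTable.Sound`; a proved instance is
  `stdLogTable_sound`, `LogTableStd.lean`), and for every rational `p` occurring in an atom a SMOOTH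
  SURROGATE `p₀ = ∏ q_k^{e_k}`, `e_k ∈ ℤ`, shipped packed into one natural (`unpackExps`).
* **Mathematics** (elementary, [folklore]). `1 − p₀/p ≤ ln(p/p₀) ≤ p/p₀ − 1`
  (`Real.one_sub_inv_le_log_of_pos`, `Real.log_le_sub_one_of_pos`), whence
  `ln p ∈ ln p₀ + [1 − p₀/p, p/p₀ − 1]` (`log_surrogate_lower/upper`) and, for `A ≤ ln p₀ ≤ B`,
  `−p ln p ∈ [p − p²/p₀ − pB, p₀ − p − pA]` (`negMulLog_surrogate_lower/upper`): intervals of width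
  `(p − p₀)²/(p p₀)` resp. `(p − p₀)²/p₀ + p(B − A)`; and `ln p₀ = ∑ e_k ln q_k` is enclosed from the
  table (`smoothLog_bounds`).
* **Arithmetic.** The four enclosures are evaluated in integer fixed point at a working scale `2^S`,
  `S ≤ L`, with directed rounding (`zfloorDiv`, `zceilDiv`): `lgLo/lgHi` for `2^S ln(a/d)`,
  `nmlLo/nmlHi` for `2^S·(−p ln p)`, summed over the entries of an entropy atom (`nmlSumLo/Hi`,
  `LogAtom.lo/hi`); PROVED sound for `S ≤ L` and a sound table (`lgLo_le`, `le_lgHi`, `nmlLo_le`,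
  `le_nmlHi`, `LogAtom.lo_le`, `LogAtom.le_hi`) — for ANY surrogate (a bad surrogate only widens the
  interval), so the offline search that finds surrogates is not trusted.
* **Checker.** `LinCert` = a scale `S` and terms `(c_j ∈ ℤ, atom_j, packed surrogates)`;
  `LinCert.check T cert b : Bool` tests `S ≤ L` and `b ≤ ∑_j c_j · (lo_j if c_j ≥ 0 else hi_j)`, a
  closed computation on integer literals that the kernel evaluates (`decide +kernel`) in time linear
  in the data; **`LinCert.le_of_check`: `T.Sound → check T cert b = true → b ≤ 2^S · ∑_j c_j v_j`**
  over `ℝ`; upper bounds via the negated certificate (`LinCert.le_div_of_check_neg`); chunking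
  (`termsVal_append`, `le_of_check_chunks`) and the bridge to `Fin`-indexed sums
  (`LogAtom.val_nml_ofFn`) for users whose entropies are `∑ i, negMulLog (v i / d)`.

Intended use (the numerics of `vxxz2024_omega_le` and its relatives): identify the real inequality
with `b ≤ 2^S * cert.val` by `simp only [LinCert.val, termsVal, LogAtom.val_nml_ofFn, …]`, then
`exact LinCert.le_of_check stdLogTable_sound (by decide +kernel)`.

## References

* V. Vassilevska Williams, Y. Xu, Z. Xu, R. Zhou, *New bounds for matrix multiplication: from alpha
  to omega*, SODA 2024, arXiv:2307.07970, §8 (the optimisation problem; "we can precisely calculate …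
  Plugging them into (asymptotic sum inequality) would verify the correctness of the claimed bound";
  the published verifier accepts floating-point residuals `≤ 1.1·10⁻⁶`). [VassilevskaWilliamsXuXuZhou2024]
-/

namespace Literature.Computability.AlgebraicComplexity

open Real

/-! ## Directed rounding of integer quotients -/

section Rounding

/-- Floor of `x / y` for an integer `x` and a natural `y > 0` (Lean's `Int` division is flooring for
positive divisors). [folklore] -/
def zfloorDiv (x : ℤ) (y : ℕ) : ℤ := x / (y : ℤ)

/-- Ceiling of `x / y` for an integer `x` and a natural `y > 0`. [folklore] -/
def zceilDiv (x : ℤ) (y : ℕ) : ℤ := -((-x) / (y : ℤ))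

/-- `⌊x/y⌋ ≤ x/y`. [folklore] -/
theorem cast_zfloorDiv_le (x : ℤ) {y : ℕ} (hy : 0 < y) : ((zfloorDiv x y : ℤ) : ℝ) ≤ (x : ℝ) / y := by
  have hy' : (0 : ℤ) < y := by exact_mod_cast hy
  have h1 : (y : ℤ) * (x / (y : ℤ)) ≤ x := by
    have := Int.mul_ediv_add_emod x (y : ℤ)
    have h2 := Int.emod_nonneg x hy'.ne'
    linarith
  have hyR : (0 : ℝ) < y := by exact_mod_cast hy
  rw [zfloorDiv, le_div_iff₀ hyR]
  have : (((y : ℤ) * (x / (y : ℤ)) : ℤ) : ℝ) ≤ (x : ℝ) := by exact_mod_cast h1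
  push_cast at this
  linarith

/-- `x/y ≤ ⌈x/y⌉`. [folklore] -/
theorem le_cast_zceilDiv (x : ℤ) {y : ℕ} (hy : 0 < y) : (x : ℝ) / y ≤ ((zceilDiv x y : ℤ) : ℝ) := by
  have h := cast_zfloorDiv_le (-x) hy
  rw [zceilDiv, Int.cast_neg]
  rw [zfloorDiv, Int.cast_neg, neg_div] at h
  linarith

end Rounding

/-! ## Smooth surrogates and tables of prime logarithms -/

section Smooth

/-- Numerator `∏_{e_k > 0} q_k^{e_k}` of the smooth number `∏ q_k^{e_k}`. [folklore] -/
def smoothNum : List ℕ → List ℤ → ℕ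
  | q :: qs, e :: es => q ^ e.toNat * smoothNum qs es
  | _, _ => 1

/-- Denominator `∏_{e_k < 0} q_k^{-e_k}` of the smooth number `∏ q_k^{e_k}`. [folklore] -/
def smoothDen : List ℕ → List ℤ → ℕ
  | q :: qs, e :: es => q ^ (-e).toNat * smoothDen qs es
  | _, _ => 1

/-- Lower bound (at the table's scale) for `ln ∏ q_k^{e_k} = ∑ e_k ln q_k` from enclosures
`lo_k ≤ 2^L ln q_k ≤ hi_k`. [folklore] -/
def smoothLogLo : List ℤ → List ℤ → List ℤ → ℤ
  | l :: ls, h :: hs, e :: es => (if 0 ≤ e then e * l else e * h) + smoothLogLo ls hs es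
  | _, _, _ => 0

/-- Upper bound (at the table's scale) for `ln ∏ q_k^{e_k}`. [folklore] -/
def smoothLogHi : List ℤ → List ℤ → List ℤ → ℤ
  | l :: ls, h :: hs, e :: es => (if 0 ≤ e then e * h else e * l) + smoothLogHi ls hs es
  | _, _, _ => 0

/-- Soundness of a table of prime logarithms: entry `k` encloses `2^L · ln q_k`, `q_k > 0`, and the
three lists have the same length. [folklore] -/
def LogTableSound (L : ℕ) : List ℕ → List ℤ → List ℤ → Prop
  | [], [], [] => True
  | q :: qs, l :: ls, h :: hs =>
      0 < q ∧ (l : ℝ) ≤ 2 ^ L * Real.log q ∧ 2 ^ L * Real.log q ≤ h ∧ LogTableSound L qs ls hs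
  | _, _, _ => False

/-- The smooth numerator is positive when all primes of the table are. [folklore] -/
theorem smoothNum_pos {L : ℕ} : ∀ {qs : List ℕ} {ls hs : List ℤ} (es : List ℤ),
    LogTableSound L qs ls hs → 0 < smoothNum qs es
  | [], [], [], es, _ => by cases es <;> simp [smoothNum]
  | q :: qs, l :: ls, h :: hs, [], _ => by simp [smoothNum]
  | q :: qs, l :: ls, h :: hs, e :: es, hT => by
      obtain ⟨hq, -, -, hT'⟩ := hT
      simp only [smoothNum]
      exact Nat.mul_pos (Nat.pow_pos hq) (smoothNum_pos es hT')
  | [], [], _ :: _, _, hT => hT.elim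
  | [], _ :: _, _, _, hT => by cases hT
  | _ :: _, [], _, _, hT => by cases hT
  | _ :: _, _ :: _, [], _, hT => by cases hT

/-- The smooth denominator is positive when all primes of the table are. [folklore] -/
theorem smoothDen_pos {L : ℕ} : ∀ {qs : List ℕ} {ls hs : List ℤ} (es : List ℤ),
    LogTableSound L qs ls hs → 0 < smoothDen qs es
  | [], [], [], es, _ => by cases es <;> simp [smoothDen]
  | q :: qs, l :: ls, h :: hs, [], _ => by simp [smoothDen]
  | q :: qs, l :: ls, h :: hs, e :: es, hT => by
      obtain ⟨hq, -, -, hT'⟩ := hT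
      simp only [smoothDen]
      exact Nat.mul_pos (Nat.pow_pos hq) (smoothDen_pos es hT')
  | [], [], _ :: _, _, hT => hT.elim
  | [], _ :: _, _, _, hT => by cases hT
  | _ :: _, [], _, _, hT => by cases hT
  | _ :: _, _ :: _, [], _, hT => by cases hT

/-- `e ln q` for an integer exponent, split into the positive and negative parts used by
`smoothNum`/`smoothDen`. [folklore] -/
theorem log_pow_toNat_sub (q : ℕ) (e : ℤ) :
    Real.log ((q : ℝ) ^ e.toNat) - Real.log ((q : ℝ) ^ (-e).toNat) = e * Real.log q := by
  rw [Real.log_pow, Real.log_pow]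
  rcases le_or_gt 0 e with he | he
  · have h1 : ((-e).toNat : ℝ) = 0 := by
      have : (-e).toNat = 0 := Int.toNat_of_nonpos (by linarith)
      simp [this]
    have h2 : ((e.toNat : ℕ) : ℝ) = (e : ℝ) := by
      have : ((e.toNat : ℕ) : ℤ) = e := Int.toNat_of_nonneg he
      exact_mod_cast this
    rw [h1, h2]; ring
  · have h1 : ((e.toNat : ℕ) : ℝ) = 0 := by
      have : e.toNat = 0 := Int.toNat_of_nonpos he.le
      simp [this]
    have h2 : (((-e).toNat : ℕ) : ℝ) = -(e : ℝ) := by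
      have : (((-e).toNat : ℕ) : ℤ) = -e := Int.toNat_of_nonneg (by linarith)
      exact_mod_cast this
    rw [h1, h2]; ring

/-- **Soundness of the smooth-surrogate logarithm bounds**:
`smoothLogLo ≤ 2^L · ln (smoothNum/smoothDen) ≤ smoothLogHi`. [folklore] -/
theorem smoothLog_bounds (L : ℕ) : ∀ (qs : List ℕ) (ls hs : List ℤ) (es : List ℤ),
    LogTableSound L qs ls hs →
      (smoothLogLo ls hs es : ℝ) ≤ 2 ^ L * Real.log ((smoothNum qs es : ℝ) / smoothDen qs es) ∧
      2 ^ L * Real.log ((smoothNum qs es : ℝ) / smoothDen qs es) ≤ (smoothLogHi ls hs es : ℝ)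
  | [], [], [], es, _ => by cases es <;> simp [smoothLogLo, smoothLogHi, smoothNum, smoothDen]
  | q :: qs, l :: ls, h :: hs, [], _ => by simp [smoothLogLo, smoothLogHi, smoothNum, smoothDen]
  | q :: qs, l :: ls, h :: hs, e :: es, hT => by
      obtain ⟨hq, hl, hh, hT'⟩ := hT
      obtain ⟨ihlo, ihhi⟩ := smoothLog_bounds L qs ls hs es hT'
      have hN : (0 : ℝ) < smoothNum qs es := by exact_mod_cast smoothNum_pos es hT'
      have hD : (0 : ℝ) < smoothDen qs es := by exact_mod_cast smoothDen_pos es hT'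
      have hqR : (0 : ℝ) < q := by exact_mod_cast hq
      have hsplit : Real.log ((smoothNum (q :: qs) (e :: es) : ℝ) / smoothDen (q :: qs) (e :: es)) =
          e * Real.log q + Real.log ((smoothNum qs es : ℝ) / smoothDen qs es) := by
        simp only [smoothNum, smoothDen, Nat.cast_mul, Nat.cast_pow]
        rw [Real.log_div (by positivity) (by positivity), Real.log_mul (by positivity) hN.ne',
          Real.log_mul (by positivity) hD.ne', Real.log_div hN.ne' hD.ne', ← log_pow_toNat_sub q e]
        ring
      simp only [smoothLogLo, smoothLogHi, Int.cast_add, hsplit, mul_add]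
      constructor
      · refine add_le_add ?_ ihlo
        split_ifs with he
        · have he' : (0 : ℝ) ≤ e := by exact_mod_cast he
          push_cast; nlinarith
        · have he' : (e : ℝ) ≤ 0 := by exact_mod_cast (le_of_lt (not_le.mp he))
          push_cast; nlinarith
      · refine add_le_add ?_ ihhi
        split_ifs with he
        · have he' : (0 : ℝ) ≤ e := by exact_mod_cast he
          push_cast; nlinarith
        · have he' : (e : ℝ) ≤ 0 := by exact_mod_cast (le_of_lt (not_le.mp he))
          push_cast; nlinarith
  | [], [], _ :: _, _, hT => hT.elim
  | [], _ :: _, _, _, hT => by cases hT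
  | _ :: _, [], _, _, hT => by cases hT
  | _ :: _, _ :: _, [], _, hT => by cases hT

end Smooth


/-! ## Atoms, their certified fixed-point enclosures, and the elementary real inequalities -/

section Atoms

/-- **`ln p ≥ ln p₀ + (1 − p₀/p)`** for `p, p₀ > 0`. [folklore] -/
theorem log_surrogate_lower {p p₀ : ℝ} (hp : 0 < p) (hp₀ : 0 < p₀) :
    Real.log p₀ + (1 - p₀ / p) ≤ Real.log p := by
  have h := Real.one_sub_inv_le_log_of_pos (div_pos hp hp₀)
  rw [Real.log_div hp.ne' hp₀.ne', inv_div] at h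
  linarith

/-- **`ln p ≤ ln p₀ + (p/p₀ − 1)`** for `p, p₀ > 0`. [folklore] -/
theorem log_surrogate_upper {p p₀ : ℝ} (hp : 0 < p) (hp₀ : 0 < p₀) :
    Real.log p ≤ Real.log p₀ + (p / p₀ - 1) := by
  have h := Real.log_le_sub_one_of_pos (div_pos hp hp₀)
  rw [Real.log_div hp.ne' hp₀.ne'] at h
  linarith

/-- **`−p ln p ≥ p − p²/p₀ − p·B`** for `0 ≤ p`, `0 < p₀`, `ln p₀ ≤ B`. [folklore] -/
theorem negMulLog_surrogate_lower {p p₀ B : ℝ} (hp : 0 ≤ p) (hp₀ : 0 < p₀) (hB : Real.log p₀ ≤ B) :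
    p - p ^ 2 / p₀ - p * B ≤ Real.negMulLog p := by
  rcases hp.eq_or_lt with rfl | hp'
  · simp [Real.negMulLog_zero]
  have h := log_surrogate_upper hp' hp₀
  rw [Real.negMulLog, neg_mul]
  have : p * Real.log p ≤ p * (B + (p / p₀ - 1)) := mul_le_mul_of_nonneg_left (by linarith) hp
  have e : p * (B + (p / p₀ - 1)) = p * B + p ^ 2 / p₀ - p := by ring
  linarith

/-- **`−p ln p ≤ p₀ − p − p·A`** for `0 ≤ p`, `0 < p₀`, `A ≤ ln p₀`. [folklore] -/
theorem negMulLog_surrogate_upper {p p₀ A : ℝ} (hp : 0 ≤ p) (hp₀ : 0 < p₀) (hA : A ≤ Real.log p₀) :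
    Real.negMulLog p ≤ p₀ - p - p * A := by
  rcases hp.eq_or_lt with rfl | hp'
  · simp [Real.negMulLog_zero, hp₀.le]
  have h := log_surrogate_lower hp' hp₀
  rw [Real.negMulLog, neg_mul]
  have : p * (A + (1 - p₀ / p)) ≤ p * Real.log p := mul_le_mul_of_nonneg_left (by linarith) hp
  have e : p * (A + (1 - p₀ / p)) = p * A + p - p₀ := by field_simp; ring
  linarith

/-- An atom of a log-linear form: `lg a d` is `ln(a/d)`; `nml d as` is the entropy sum
`∑_{a ∈ as} −(a/d) ln(a/d)` of the rational vector `as/d`. [folklore] -/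
inductive LogAtom
  | lg (a d : ℕ)
  | nml (d : ℕ) (as : List ℕ)

/-- The real value of an atom. [folklore] -/
noncomputable def LogAtom.val : LogAtom → ℝ
  | .lg a d => Real.log ((a : ℝ) / d)
  | .nml d as => (as.map fun a : ℕ => Real.negMulLog ((a : ℝ) / d)).sum

/-- A table of enclosures of prime logarithms at scale `2^L`: `lo_k ≤ 2^L ln q_k ≤ hi_k`.
[folklore] -/
structure LogTable where
  /-- the scale exponent `L` -/
  L : ℕ
  /-- the primes (any positive naturals) -/
  qs : List ℕ
  /-- lower bounds of `2^L ln q_k` -/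
  lo : List ℤ
  /-- upper bounds of `2^L ln q_k` -/
  hi : List ℤ

/-- Soundness of a `LogTable`. [folklore] -/
def LogTable.Sound (T : LogTable) : Prop := LogTableSound T.L T.qs T.lo T.hi

/-- Lower bound of `2^S ln(a/d)` from the surrogate `es`: `⌊A_lo/2^{L−S}⌋ + 2^S − ⌈p₀ 2^S/p⌉`
(sound for `S ≤ T.L`, `a, d > 0`: `lgLo_le`; for `S > L` the `ℕ`-subtraction makes it meaningless and
`LinCert.check` rejects such scales). [folklore] -/
def lgLo (T : LogTable) (S : ℕ) (a d : ℕ) (es : List ℤ) : ℤ :=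
  zfloorDiv (smoothLogLo T.lo T.hi es) (2 ^ (T.L - S)) + 2 ^ S -
    zceilDiv ((smoothNum T.qs es * d * 2 ^ S : ℕ) : ℤ) (smoothDen T.qs es * a)

/-- Upper bound of `2^S ln(a/d)` from the surrogate `es`: `⌈A_hi/2^{L−S}⌉ + ⌈p 2^S/p₀⌉ − 2^S`
(sound for `S ≤ T.L`, `a, d > 0`: `le_lgHi`). [folklore] -/
def lgHi (T : LogTable) (S : ℕ) (a d : ℕ) (es : List ℤ) : ℤ :=
  zceilDiv (smoothLogHi T.lo T.hi es) (2 ^ (T.L - S)) +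
    zceilDiv ((a * smoothDen T.qs es * 2 ^ S : ℕ) : ℤ) (d * smoothNum T.qs es) - 2 ^ S

/-- Lower bound of `2^S · (−p ln p)`, `p = a/d`, from the surrogate `es`:
`⌊2^S p⌋ − ⌈2^S p²/p₀⌉ − ⌈2^S p A_hi/2^L⌉` (and `0` for `a = 0`; sound for `S ≤ T.L`, `d > 0`:
`nmlLo_le`). [folklore] -/
def nmlLo (T : LogTable) (S : ℕ) (d a : ℕ) (es : List ℤ) : ℤ :=
  if a = 0 then 0 else
    zfloorDiv ((a * 2 ^ S : ℕ) : ℤ) d -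
      zceilDiv ((a * a * smoothDen T.qs es * 2 ^ S : ℕ) : ℤ) (d * d * smoothNum T.qs es) -
      zceilDiv ((a : ℤ) * smoothLogHi T.lo T.hi es) (d * 2 ^ (T.L - S))

/-- Upper bound of `2^S · (−p ln p)`, `p = a/d`, from the surrogate `es`:
`⌈2^S p₀⌉ − ⌊2^S p⌋ − ⌊2^S p A_lo/2^L⌋` (and `0` for `a = 0`; sound for `S ≤ T.L`, `d > 0`:
`le_nmlHi`). [folklore] -/
def nmlHi (T : LogTable) (S : ℕ) (d a : ℕ) (es : List ℤ) : ℤ :=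
  if a = 0 then 0 else
    zceilDiv ((smoothNum T.qs es * 2 ^ S : ℕ) : ℤ) (smoothDen T.qs es) -
      zfloorDiv ((a * 2 ^ S : ℕ) : ℤ) d -
      zfloorDiv ((a : ℤ) * smoothLogLo T.lo T.hi es) (d * 2 ^ (T.L - S))

/-- A surrogate exponent vector is shipped PACKED into one natural number, 4 bits per exponent
(`e_k + 8 ∈ [0, 15]`, least significant first); `unpackExps k n` recovers the first `k` exponents.
(Packing only shrinks the certificate literal; soundness holds for any exponent vector.) [folklore] -/
def unpackExps : ℕ → ℕ → List ℤ
  | 0, _ => []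
  | k + 1, n => (((n % 16 : ℕ) : ℤ) - 8) :: unpackExps k (n / 16)

/-- Sum of the lower bounds of the entries of an entropy atom (one packed surrogate per entry;
missing surrogates make the check fail later by returning `none`). [folklore] -/
def nmlSumLo (T : LogTable) (S d : ℕ) : List ℕ → List ℕ → Option ℤ
  | [], _ => some 0
  | a :: as, n :: ns => (nmlSumLo T S d as ns).map (nmlLo T S d a (unpackExps T.qs.length n) + ·)
  | _ :: _, [] => none

/-- Sum of the upper bounds of the entries of an entropy atom. [folklore] -/
def nmlSumHi (T : LogTable) (S d : ℕ) : List ℕ → List ℕ → Option ℤ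
  | [], _ => some 0
  | a :: as, n :: ns => (nmlSumHi T S d as ns).map (nmlHi T S d a (unpackExps T.qs.length n) + ·)
  | _ :: _, [] => none

/-- The certified lower bound of `2^S · (atom value)`, `none` if the atom or its certificate is
ill-formed; the certificate is the list of packed surrogates (one for `lg`, one per entry for
`nml`). [folklore] -/
def LogAtom.lo (T : LogTable) (S : ℕ) : LogAtom → List ℕ → Option ℤ
  | .lg a d, ns => if a = 0 ∨ d = 0 then none else some (lgLo T S a d (unpackExps T.qs.length (ns.headD 0)))
  | .nml d as, ns => if d = 0 then none else nmlSumLo T S d as ns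

/-- The certified upper bound of `2^S · (atom value)`. [folklore] -/
def LogAtom.hi (T : LogTable) (S : ℕ) : LogAtom → List ℕ → Option ℤ
  | .lg a d, ns => if a = 0 ∨ d = 0 then none else some (lgHi T S a d (unpackExps T.qs.length (ns.headD 0)))
  | .nml d as, ns => if d = 0 then none else nmlSumHi T S d as ns

end Atoms



/-! ## Soundness of the atom enclosures -/

section AtomSound

variable (T : LogTable) (S : ℕ)

/-- `2^{L−S} · 2^S = 2^L` over `ℝ` for `S ≤ L`. [folklore] -/
theorem two_pow_sub_mul_two_pow {L S : ℕ} (hS : S ≤ L) : (2 : ℝ) ^ (L - S) * 2 ^ S = 2 ^ L := by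
  rw [← pow_add, Nat.sub_add_cancel hS]

/-- The surrogate `p₀ = smoothNum/smoothDen` of a sound table is positive. [folklore] -/
theorem surrogate_pos {T : LogTable} (hT : T.Sound) (es : List ℤ) :
    (0 : ℝ) < (smoothNum T.qs es : ℝ) / smoothDen T.qs es := by
  have hN : (0 : ℝ) < smoothNum T.qs es := by exact_mod_cast smoothNum_pos es hT
  have hD : (0 : ℝ) < smoothDen T.qs es := by exact_mod_cast smoothDen_pos es hT
  positivity

/-- Lower table bound rescaled: `⌊A_lo / 2^{L−S}⌋ ≤ 2^S ln p₀`. [folklore] -/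
theorem zfloorDiv_smoothLogLo_le {T : LogTable} (hT : T.Sound) {S : ℕ} (hS : S ≤ T.L) (es : List ℤ) :
    ((zfloorDiv (smoothLogLo T.lo T.hi es) (2 ^ (T.L - S)) : ℤ) : ℝ) ≤
      2 ^ S * Real.log ((smoothNum T.qs es : ℝ) / smoothDen T.qs es) := by
  have hpow : (0 : ℕ) < 2 ^ (T.L - S) := Nat.pos_of_ne_zero (by positivity)
  refine (cast_zfloorDiv_le _ hpow).trans ?_
  have hb := (smoothLog_bounds T.L T.qs T.lo T.hi es hT).1
  have h2 : (0 : ℝ) < (2 : ℝ) ^ (T.L - S) := by positivity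
  rw [Nat.cast_pow, Nat.cast_ofNat, div_le_iff₀ h2]
  calc (smoothLogLo T.lo T.hi es : ℝ) ≤ 2 ^ T.L * Real.log ((smoothNum T.qs es : ℝ) / smoothDen T.qs es) := hb
    _ = 2 ^ S * Real.log ((smoothNum T.qs es : ℝ) / smoothDen T.qs es) * 2 ^ (T.L - S) := by
        rw [← two_pow_sub_mul_two_pow hS]; ring

/-- Upper table bound rescaled: `2^S ln p₀ ≤ ⌈A_hi / 2^{L−S}⌉`. [folklore] -/
theorem le_zceilDiv_smoothLogHi {T : LogTable} (hT : T.Sound) {S : ℕ} (hS : S ≤ T.L) (es : List ℤ) :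
    2 ^ S * Real.log ((smoothNum T.qs es : ℝ) / smoothDen T.qs es) ≤
      ((zceilDiv (smoothLogHi T.lo T.hi es) (2 ^ (T.L - S)) : ℤ) : ℝ) := by
  have hpow : (0 : ℕ) < 2 ^ (T.L - S) := Nat.pos_of_ne_zero (by positivity)
  refine le_trans ?_ (le_cast_zceilDiv _ hpow)
  have hb := (smoothLog_bounds T.L T.qs T.lo T.hi es hT).2
  have h2 : (0 : ℝ) < (2 : ℝ) ^ (T.L - S) := by positivity
  rw [Nat.cast_pow, Nat.cast_ofNat, le_div_iff₀ h2]
  calc 2 ^ S * Real.log ((smoothNum T.qs es : ℝ) / smoothDen T.qs es) * 2 ^ (T.L - S)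
        = 2 ^ T.L * Real.log ((smoothNum T.qs es : ℝ) / smoothDen T.qs es) := by
          rw [← two_pow_sub_mul_two_pow hS]; ring
    _ ≤ (smoothLogHi T.lo T.hi es : ℝ) := hb

/-- **Soundness of `lgLo`**: `lgLo ≤ 2^S ln(a/d)`. [folklore] -/
theorem lgLo_le {T : LogTable} (hT : T.Sound) {S : ℕ} (hS : S ≤ T.L) {a d : ℕ} (ha : 0 < a) (hd : 0 < d)
    (es : List ℤ) : ((lgLo T S a d es : ℤ) : ℝ) ≤ 2 ^ S * Real.log ((a : ℝ) / d) := by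
  have hN0 := smoothNum_pos es hT
  have hD0 := smoothDen_pos es hT
  have hN : (0 : ℝ) < smoothNum T.qs es := by exact_mod_cast hN0
  have hD : (0 : ℝ) < smoothDen T.qs es := by exact_mod_cast hD0
  have haR : (0 : ℝ) < a := by exact_mod_cast ha
  have hdR : (0 : ℝ) < d := by exact_mod_cast hd
  have hp₀pos : (0 : ℝ) < (smoothNum T.qs es : ℝ) / smoothDen T.qs es := div_pos hN hD
  have hp : (0 : ℝ) < (a : ℝ) / d := div_pos haR hdR
  have h1 := zfloorDiv_smoothLogLo_le hT hS es
  have h2 : 2 ^ S * ((smoothNum T.qs es : ℝ) / smoothDen T.qs es) / ((a : ℝ) / d) ≤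
      ((zceilDiv ((smoothNum T.qs es * d * 2 ^ S : ℕ) : ℤ) (smoothDen T.qs es * a) : ℤ) : ℝ) := by
    refine le_trans (le_of_eq ?_) (le_cast_zceilDiv _ (Nat.mul_pos hD0 ha))
    push_cast
    field_simp
  have h3 := log_surrogate_lower hp hp₀pos
  have e : (2 : ℝ) ^ S * (Real.log ((smoothNum T.qs es : ℝ) / smoothDen T.qs es) +
      (1 - (smoothNum T.qs es : ℝ) / smoothDen T.qs es / ((a : ℝ) / d))) ≤ 2 ^ S * Real.log ((a : ℝ) / d) :=
    mul_le_mul_of_nonneg_left h3 (by positivity)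
  have e2 : (2 : ℝ) ^ S * (Real.log ((smoothNum T.qs es : ℝ) / smoothDen T.qs es) +
      (1 - (smoothNum T.qs es : ℝ) / smoothDen T.qs es / ((a : ℝ) / d))) =
      2 ^ S * Real.log ((smoothNum T.qs es : ℝ) / smoothDen T.qs es) + 2 ^ S -
        2 ^ S * ((smoothNum T.qs es : ℝ) / smoothDen T.qs es) / ((a : ℝ) / d) := by ring
  unfold lgLo
  push_cast at h1 h2 ⊢
  linarith

/-- **Soundness of `lgHi`**: `2^S ln(a/d) ≤ lgHi`. [folklore] -/
theorem le_lgHi {T : LogTable} (hT : T.Sound) {S : ℕ} (hS : S ≤ T.L) {a d : ℕ} (ha : 0 < a) (hd : 0 < d)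
    (es : List ℤ) : 2 ^ S * Real.log ((a : ℝ) / d) ≤ ((lgHi T S a d es : ℤ) : ℝ) := by
  have hN0 := smoothNum_pos es hT
  have hD0 := smoothDen_pos es hT
  have hN : (0 : ℝ) < smoothNum T.qs es := by exact_mod_cast hN0
  have hD : (0 : ℝ) < smoothDen T.qs es := by exact_mod_cast hD0
  have haR : (0 : ℝ) < a := by exact_mod_cast ha
  have hdR : (0 : ℝ) < d := by exact_mod_cast hd
  have hp₀pos : (0 : ℝ) < (smoothNum T.qs es : ℝ) / smoothDen T.qs es := div_pos hN hD
  have hp : (0 : ℝ) < (a : ℝ) / d := div_pos haR hdR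
  have h1 := le_zceilDiv_smoothLogHi hT hS es
  have h2 : 2 ^ S * ((a : ℝ) / d) / ((smoothNum T.qs es : ℝ) / smoothDen T.qs es) ≤
      ((zceilDiv ((a * smoothDen T.qs es * 2 ^ S : ℕ) : ℤ) (d * smoothNum T.qs es) : ℤ) : ℝ) := by
    refine le_trans (le_of_eq ?_) (le_cast_zceilDiv _ (Nat.mul_pos hd hN0))
    push_cast
    field_simp
  have h3 := log_surrogate_upper hp hp₀pos
  have e : (2 : ℝ) ^ S * Real.log ((a : ℝ) / d) ≤ 2 ^ S * (Real.log ((smoothNum T.qs es : ℝ) / smoothDen T.qs es) +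
      ((a : ℝ) / d / ((smoothNum T.qs es : ℝ) / smoothDen T.qs es) - 1)) :=
    mul_le_mul_of_nonneg_left h3 (by positivity)
  have e2 : (2 : ℝ) ^ S * (Real.log ((smoothNum T.qs es : ℝ) / smoothDen T.qs es) +
      ((a : ℝ) / d / ((smoothNum T.qs es : ℝ) / smoothDen T.qs es) - 1)) =
      2 ^ S * Real.log ((smoothNum T.qs es : ℝ) / smoothDen T.qs es) +
        2 ^ S * ((a : ℝ) / d) / ((smoothNum T.qs es : ℝ) / smoothDen T.qs es) - 2 ^ S := by ring
  unfold lgHi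
  push_cast at h1 h2 ⊢
  linarith

/-- **Soundness of `nmlLo`**: `nmlLo ≤ 2^S · (−p ln p)`, `p = a/d`. [folklore] -/
theorem nmlLo_le {T : LogTable} (hT : T.Sound) {S : ℕ} (hS : S ≤ T.L) {d : ℕ} (hd : 0 < d) (a : ℕ)
    (es : List ℤ) : ((nmlLo T S d a es : ℤ) : ℝ) ≤ 2 ^ S * Real.negMulLog ((a : ℝ) / d) := by
  unfold nmlLo
  split_ifs with ha
  · subst ha; simp [Real.negMulLog_zero]
  have ha' : 0 < a := Nat.pos_of_ne_zero ha
  have hN0 := smoothNum_pos es hT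
  have hD0 := smoothDen_pos es hT
  have hN : (0 : ℝ) < smoothNum T.qs es := by exact_mod_cast hN0
  have hD : (0 : ℝ) < smoothDen T.qs es := by exact_mod_cast hD0
  have haR : (0 : ℝ) < a := by exact_mod_cast ha'
  have hdR : (0 : ℝ) < d := by exact_mod_cast hd
  have hp₀pos : (0 : ℝ) < (smoothNum T.qs es : ℝ) / smoothDen T.qs es := div_pos hN hD
  have hp0 : (0 : ℝ) ≤ (a : ℝ) / d := by positivity
  -- the three rounded pieces
  have h1 : ((zfloorDiv ((a * 2 ^ S : ℕ) : ℤ) d : ℤ) : ℝ) ≤ 2 ^ S * ((a : ℝ) / d) := by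
    refine (cast_zfloorDiv_le _ hd).trans (le_of_eq ?_)
    push_cast; ring
  have h2 : 2 ^ S * ((a : ℝ) / d) ^ 2 / ((smoothNum T.qs es : ℝ) / smoothDen T.qs es) ≤
      ((zceilDiv ((a * a * smoothDen T.qs es * 2 ^ S : ℕ) : ℤ) (d * d * smoothNum T.qs es) : ℤ) : ℝ) := by
    refine le_trans (le_of_eq ?_) (le_cast_zceilDiv _ (Nat.mul_pos (Nat.mul_pos hd hd) hN0))
    push_cast; field_simp
  have hpow : (0 : ℕ) < d * 2 ^ (T.L - S) := Nat.mul_pos hd (Nat.pos_of_ne_zero (by positivity))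
  have h3 : 2 ^ S * ((a : ℝ) / d) * ((smoothLogHi T.lo T.hi es : ℝ) / 2 ^ T.L) ≤
      ((zceilDiv ((a : ℤ) * smoothLogHi T.lo T.hi es) (d * 2 ^ (T.L - S)) : ℤ) : ℝ) := by
    refine le_trans (le_of_eq ?_) (le_cast_zceilDiv _ hpow)
    push_cast
    rw [← two_pow_sub_mul_two_pow hS]
    field_simp
  have hlogB : Real.log ((smoothNum T.qs es : ℝ) / smoothDen T.qs es) ≤ (smoothLogHi T.lo T.hi es : ℝ) / 2 ^ T.L := by
    rw [le_div_iff₀ (by positivity)]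
    have h' := (smoothLog_bounds T.L T.qs T.lo T.hi es hT).2
    linarith
  have h4 := negMulLog_surrogate_lower hp0 hp₀pos hlogB
  have e : (2 : ℝ) ^ S * ((a : ℝ) / d - ((a : ℝ) / d) ^ 2 / ((smoothNum T.qs es : ℝ) / smoothDen T.qs es) -
      (a : ℝ) / d * ((smoothLogHi T.lo T.hi es : ℝ) / 2 ^ T.L)) ≤ 2 ^ S * Real.negMulLog ((a : ℝ) / d) :=
    mul_le_mul_of_nonneg_left h4 (by positivity)
  have e2 : (2 : ℝ) ^ S * ((a : ℝ) / d - ((a : ℝ) / d) ^ 2 / ((smoothNum T.qs es : ℝ) / smoothDen T.qs es) -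
      (a : ℝ) / d * ((smoothLogHi T.lo T.hi es : ℝ) / 2 ^ T.L)) =
      2 ^ S * ((a : ℝ) / d) - 2 ^ S * ((a : ℝ) / d) ^ 2 / ((smoothNum T.qs es : ℝ) / smoothDen T.qs es) -
        2 ^ S * ((a : ℝ) / d) * ((smoothLogHi T.lo T.hi es : ℝ) / 2 ^ T.L) := by ring
  push_cast at h1 h2 h3 ⊢
  linarith

/-- **Soundness of `nmlHi`**: `2^S · (−p ln p) ≤ nmlHi`, `p = a/d`. [folklore] -/
theorem le_nmlHi {T : LogTable} (hT : T.Sound) {S : ℕ} (hS : S ≤ T.L) {d : ℕ} (hd : 0 < d) (a : ℕ)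
    (es : List ℤ) : 2 ^ S * Real.negMulLog ((a : ℝ) / d) ≤ ((nmlHi T S d a es : ℤ) : ℝ) := by
  unfold nmlHi
  split_ifs with ha
  · subst ha; simp [Real.negMulLog_zero]
  have ha' : 0 < a := Nat.pos_of_ne_zero ha
  have hN0 := smoothNum_pos es hT
  have hD0 := smoothDen_pos es hT
  have hN : (0 : ℝ) < smoothNum T.qs es := by exact_mod_cast hN0
  have hD : (0 : ℝ) < smoothDen T.qs es := by exact_mod_cast hD0
  have haR : (0 : ℝ) < a := by exact_mod_cast ha'
  have hdR : (0 : ℝ) < d := by exact_mod_cast hd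
  have hp₀pos : (0 : ℝ) < (smoothNum T.qs es : ℝ) / smoothDen T.qs es := div_pos hN hD
  have hp0 : (0 : ℝ) ≤ (a : ℝ) / d := by positivity
  have h1 : ((zfloorDiv ((a * 2 ^ S : ℕ) : ℤ) d : ℤ) : ℝ) ≤ 2 ^ S * ((a : ℝ) / d) := by
    refine (cast_zfloorDiv_le _ hd).trans (le_of_eq ?_)
    push_cast; ring
  have h2 : 2 ^ S * ((smoothNum T.qs es : ℝ) / smoothDen T.qs es) ≤
      ((zceilDiv ((smoothNum T.qs es * 2 ^ S : ℕ) : ℤ) (smoothDen T.qs es) : ℤ) : ℝ) := by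
    refine le_trans (le_of_eq ?_) (le_cast_zceilDiv _ hD0)
    push_cast; field_simp
  have hpow : (0 : ℕ) < d * 2 ^ (T.L - S) := Nat.mul_pos hd (Nat.pos_of_ne_zero (by positivity))
  have h3 : ((zfloorDiv ((a : ℤ) * smoothLogLo T.lo T.hi es) (d * 2 ^ (T.L - S)) : ℤ) : ℝ) ≤
      2 ^ S * ((a : ℝ) / d) * ((smoothLogLo T.lo T.hi es : ℝ) / 2 ^ T.L) := by
    refine (cast_zfloorDiv_le _ hpow).trans (le_of_eq ?_)
    push_cast
    rw [← two_pow_sub_mul_two_pow hS]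
    field_simp
  have hlogA : (smoothLogLo T.lo T.hi es : ℝ) / 2 ^ T.L ≤ Real.log ((smoothNum T.qs es : ℝ) / smoothDen T.qs es) := by
    rw [div_le_iff₀ (by positivity)]
    have h' := (smoothLog_bounds T.L T.qs T.lo T.hi es hT).1
    linarith
  have h4 := negMulLog_surrogate_upper hp0 hp₀pos hlogA
  have e : (2 : ℝ) ^ S * Real.negMulLog ((a : ℝ) / d) ≤
      2 ^ S * ((smoothNum T.qs es : ℝ) / smoothDen T.qs es - (a : ℝ) / d -
        (a : ℝ) / d * ((smoothLogLo T.lo T.hi es : ℝ) / 2 ^ T.L)) :=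
    mul_le_mul_of_nonneg_left h4 (by positivity)
  have e2 : (2 : ℝ) ^ S * ((smoothNum T.qs es : ℝ) / smoothDen T.qs es - (a : ℝ) / d -
        (a : ℝ) / d * ((smoothLogLo T.lo T.hi es : ℝ) / 2 ^ T.L)) =
      2 ^ S * ((smoothNum T.qs es : ℝ) / smoothDen T.qs es) - 2 ^ S * ((a : ℝ) / d) -
        2 ^ S * ((a : ℝ) / d) * ((smoothLogLo T.lo T.hi es : ℝ) / 2 ^ T.L) := by ring
  push_cast at h1 h2 h3 ⊢
  linarith

/-- **Soundness of `nmlSumLo`**. [folklore] -/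
theorem nmlSumLo_le {T : LogTable} (hT : T.Sound) {S : ℕ} (hS : S ≤ T.L) {d : ℕ} (hd : 0 < d) :
    ∀ (as : List ℕ) (ns : List ℕ) {v : ℤ}, nmlSumLo T S d as ns = some v →
      (v : ℝ) ≤ 2 ^ S * (as.map fun a : ℕ => Real.negMulLog ((a : ℝ) / d)).sum
  | [], _, v, hv => by
      simp only [nmlSumLo, Option.some.injEq] at hv
      subst hv; simp
  | a :: as, n :: ns, v, hv => by
      simp only [nmlSumLo] at hv
      cases h : nmlSumLo T S d as ns with
      | none => rw [h] at hv; simp at hv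
      | some w =>
          rw [h] at hv
          simp only [Option.map_some, Option.some.injEq] at hv
          subst hv
          have ih := nmlSumLo_le hT hS hd as ns h
          have h0 := nmlLo_le hT hS hd a (unpackExps T.qs.length n)
          simp only [List.map_cons, List.sum_cons, Int.cast_add, mul_add]
          exact add_le_add h0 ih
  | _ :: _, [], v, hv => by simp [nmlSumLo] at hv

/-- **Soundness of `nmlSumHi`**. [folklore] -/
theorem le_nmlSumHi {T : LogTable} (hT : T.Sound) {S : ℕ} (hS : S ≤ T.L) {d : ℕ} (hd : 0 < d) :
    ∀ (as : List ℕ) (ns : List ℕ) {v : ℤ}, nmlSumHi T S d as ns = some v →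
      2 ^ S * (as.map fun a : ℕ => Real.negMulLog ((a : ℝ) / d)).sum ≤ (v : ℝ)
  | [], _, v, hv => by
      simp only [nmlSumHi, Option.some.injEq] at hv
      subst hv; simp
  | a :: as, n :: ns, v, hv => by
      simp only [nmlSumHi] at hv
      cases h : nmlSumHi T S d as ns with
      | none => rw [h] at hv; simp at hv
      | some w =>
          rw [h] at hv
          simp only [Option.map_some, Option.some.injEq] at hv
          subst hv
          have ih := le_nmlSumHi hT hS hd as ns h
          have h0 := le_nmlHi hT hS hd a (unpackExps T.qs.length n)
          simp only [List.map_cons, List.sum_cons, Int.cast_add, mul_add]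
          exact add_le_add h0 ih
  | _ :: _, [], v, hv => by simp [nmlSumHi] at hv

/-- **Soundness of `LogAtom.lo`**: a returned bound is `≤ 2^S · (value)`. [folklore] -/
theorem LogAtom.lo_le {T : LogTable} (hT : T.Sound) {S : ℕ} (hS : S ≤ T.L) :
    ∀ (x : LogAtom) (ns : List ℕ) {v : ℤ}, x.lo T S ns = some v → (v : ℝ) ≤ 2 ^ S * x.val
  | .lg a d, ns, v, hv => by
      simp only [LogAtom.lo] at hv
      split_ifs at hv with h
      simp only [Option.some.injEq] at hv
      subst hv
      obtain ⟨h1, h2⟩ := not_or.mp h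
      exact lgLo_le hT hS (Nat.pos_of_ne_zero h1) (Nat.pos_of_ne_zero h2) _
  | .nml d as, ns, v, hv => by
      simp only [LogAtom.lo] at hv
      split_ifs at hv with h
      exact nmlSumLo_le hT hS (Nat.pos_of_ne_zero h) as ns hv

/-- **Soundness of `LogAtom.hi`**: `2^S · (value) ≤` a returned bound. [folklore] -/
theorem LogAtom.le_hi {T : LogTable} (hT : T.Sound) {S : ℕ} (hS : S ≤ T.L) :
    ∀ (x : LogAtom) (ns : List ℕ) {v : ℤ}, x.hi T S ns = some v → 2 ^ S * x.val ≤ (v : ℝ)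
  | .lg a d, ns, v, hv => by
      simp only [LogAtom.hi] at hv
      split_ifs at hv with h
      simp only [Option.some.injEq] at hv
      subst hv
      obtain ⟨h1, h2⟩ := not_or.mp h
      exact le_lgHi hT hS (Nat.pos_of_ne_zero h1) (Nat.pos_of_ne_zero h2) _
  | .nml d as, ns, v, hv => by
      simp only [LogAtom.hi] at hv
      split_ifs at hv with h
      exact le_nmlSumHi hT hS (Nat.pos_of_ne_zero h) as ns hv

end AtomSound



/-! ## The checker and its soundness theorem -/

section Check

/-- The certified lower bound of `2^S ∑ c_j v_j` for a list of terms `(c_j, atom_j, packed surrogates_j)`: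
lower atom bounds for `c_j ≥ 0`, upper ones for `c_j < 0`; `none` if some atom is ill-formed.
[folklore] -/
def termsLower (T : LogTable) (S : ℕ) : List (ℤ × LogAtom × List ℕ) → Option ℤ
  | [] => some 0
  | (c, x, ns) :: ts =>
      match (if 0 ≤ c then x.lo T S ns else x.hi T S ns), termsLower T S ts with
      | some b, some r => some (c * b + r)
      | _, _ => none

/-- The real value `∑_j c_j · v_j` of a list of terms. [folklore] -/
noncomputable def termsVal : List (ℤ × LogAtom × List ℕ) → ℝ
  | [] => 0
  | (c, x, _) :: ts => (c : ℝ) * x.val + termsVal ts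

/-- **Soundness of `termsLower`.** [folklore] -/
theorem termsLower_le {T : LogTable} (hT : T.Sound) {S : ℕ} (hS : S ≤ T.L) :
    ∀ (ts : List (ℤ × LogAtom × List ℕ)) {v : ℤ}, termsLower T S ts = some v →
      (v : ℝ) ≤ 2 ^ S * termsVal ts
  | [], v, hv => by
      simp only [termsLower, Option.some.injEq] at hv
      subst hv; simp [termsVal]
  | (c, x, ns) :: ts, v, hv => by
      simp only [termsLower] at hv
      split at hv
      · rename_i b r hb hr
        simp only [Option.some.injEq] at hv
        subst hv
        have ih := termsLower_le hT hS ts hr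
        simp only [termsVal, Int.cast_add, Int.cast_mul, mul_add]
        refine add_le_add ?_ ih
        split_ifs at hb with hc
        · have h1 := LogAtom.lo_le hT hS x ns hb
          have hc' : (0 : ℝ) ≤ c := by exact_mod_cast hc
          calc (c : ℝ) * b ≤ c * (2 ^ S * x.val) := mul_le_mul_of_nonneg_left h1 hc'
            _ = 2 ^ S * (c * x.val) := by ring
        · have h1 := LogAtom.le_hi hT hS x ns hb
          have hc' : (c : ℝ) ≤ 0 := by exact_mod_cast (le_of_lt (not_le.mp hc))
          calc (c : ℝ) * b ≤ c * (2 ^ S * x.val) := mul_le_mul_of_nonpos_left h1 hc'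
            _ = 2 ^ S * (c * x.val) := by ring
      · simp at hv

/-- A log-linear certificate: a working scale `S` and the terms `(c_j, atom_j, packed surrogates_j)`.
[folklore] -/
structure LinCert where
  /-- working scale exponent (`2^S`); must be `≤` the table's `L` -/
  S : ℕ
  /-- the terms: integer coefficient, atom, surrogate exponent vectors (one per entry of the atom) -/
  terms : List (ℤ × LogAtom × List ℕ)

/-- The real value `∑_j c_j v_j` of a certificate. [folklore] -/
noncomputable def LinCert.val (cert : LinCert) : ℝ := termsVal cert.terms

/-- **The checker**: `S ≤ L` and the certified lower bound of `2^S · val` is at least `b`.  A closed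
`Bool` computation on integer literals (evaluate with `decide +kernel`). [folklore] -/
def LinCert.check (T : LogTable) (cert : LinCert) (b : ℤ) : Bool :=
  decide (cert.S ≤ T.L) &&
    match termsLower T cert.S cert.terms with
    | some v => decide (b ≤ v)
    | none => false

/-- **Soundness of the checker**: a passing certificate proves `b ≤ 2^S · ∑_j c_j v_j` over `ℝ`.
[folklore] -/
theorem LinCert.le_of_check {T : LogTable} (hT : T.Sound) {cert : LinCert} {b : ℤ}
    (h : cert.check T b = true) : (b : ℝ) ≤ 2 ^ cert.S * cert.val := by
  unfold LinCert.check at h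
  rw [Bool.and_eq_true, decide_eq_true_eq] at h
  obtain ⟨hS, h2⟩ := h
  split at h2
  · rename_i v hv
    rw [decide_eq_true_eq] at h2
    have h3 := termsLower_le hT hS cert.terms hv
    have h2' : (b : ℝ) ≤ v := by exact_mod_cast h2
    exact h2'.trans h3
  · simp at h2

/-- The checker's conclusion divided through: `b / 2^S ≤ ∑_j c_j v_j`. [folklore] -/
theorem LinCert.div_le_of_check {T : LogTable} (hT : T.Sound) {cert : LinCert} {b : ℤ}
    (h : cert.check T b = true) : (b : ℝ) / 2 ^ cert.S ≤ cert.val := by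
  rw [div_le_iff₀ (by positivity), mul_comm]
  exact LinCert.le_of_check hT h

/-- Upper bounds come for free: `∑ c_j v_j ≤ B / 2^S` is the lower bound `−B ≤ 2^S ∑ (−c_j) v_j` of the
negated certificate. [folklore] -/
def LinCert.neg (cert : LinCert) : LinCert :=
  ⟨cert.S, cert.terms.map fun t => (-t.1, t.2)⟩

/-- The value of the negated certificate. [folklore] -/
theorem LinCert.neg_val (cert : LinCert) : cert.neg.val = -cert.val := by
  unfold LinCert.neg LinCert.val
  induction cert.terms with
  | nil => simp [termsVal]
  | cons t ts ih =>
      obtain ⟨c, x, ns⟩ := t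
      simp only [List.map_cons, termsVal, Int.cast_neg] at ih ⊢
      rw [ih]; ring

/-- **Upper-bound form of the checker**: if `cert.neg` passes at `−B` then `∑ c_j v_j ≤ B / 2^S`.
[folklore] -/
theorem LinCert.le_div_of_check_neg {T : LogTable} (hT : T.Sound) {cert : LinCert} {B : ℤ}
    (h : cert.neg.check T (-B) = true) : cert.val ≤ (B : ℝ) / 2 ^ cert.S := by
  have h1 := LinCert.div_le_of_check hT h
  rw [LinCert.neg_val] at h1
  have hS : cert.neg.S = cert.S := rfl
  rw [hS, Int.cast_neg, neg_div] at h1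
  linarith

/-! ## Chunking and bridges to `Fin`-indexed sums -/

/-- `termsVal` is additive under concatenation (certificates may be checked in chunks, one kernel
evaluation per chunk, and the bounds added). [folklore] -/
theorem termsVal_append (l₁ l₂ : List (ℤ × LogAtom × List ℕ)) :
    termsVal (l₁ ++ l₂) = termsVal l₁ + termsVal l₂ := by
  induction l₁ with
  | nil => simp [termsVal]
  | cons t ts ih =>
      obtain ⟨c, x, ns⟩ := t
      simp only [List.cons_append, termsVal, ih, add_assoc]

/-- **Chunked soundness**: if every chunk `(terms_i, b_i)` passes at the common scale `S`, then
`∑ b_i ≤ 2^S · termsVal (terms_1 ++ ⋯ ++ terms_k)`. [folklore] -/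
theorem le_of_check_chunks {T : LogTable} (hT : T.Sound) (S : ℕ) :
    ∀ (chunks : List (List (ℤ × LogAtom × List ℕ) × ℤ)),
      (∀ ch ∈ chunks, (LinCert.mk S ch.1).check T ch.2 = true) →
      (((chunks.map Prod.snd).sum : ℤ) : ℝ) ≤ 2 ^ S * termsVal (chunks.map Prod.fst).flatten
  | [], _ => by simp [termsVal]
  | (ts, b) :: chunks, h => by
      have h1 : (LinCert.mk S ts).check T b = true := h (ts, b) (by simp)
      have h2 := le_of_check_chunks hT S chunks fun ch hch => h ch (by simp [hch])
      have h3 := LinCert.le_of_check hT h1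
      simp only [List.map_cons, List.sum_cons, Int.cast_add, List.flatten_cons, termsVal_append, mul_add]
      exact add_le_add h3 h2

/-- Bridge: the entropy atom of `List.ofFn v` is the `Fin m`-indexed sum `∑ i, −(v i/d) ln (v i/d)`
(so `Real.log 2 * shannonEntropy`-type quantities of explicit rational vectors are atom values).
[folklore] -/
theorem LogAtom.val_nml_ofFn {m : ℕ} (d : ℕ) (v : Fin m → ℕ) :
    (LogAtom.nml d (List.ofFn v)).val = ∑ i : Fin m, Real.negMulLog ((v i : ℝ) / d) := by
  simp only [LogAtom.val, List.map_ofFn, List.sum_ofFn, Function.comp_def]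

/-- Bridge: the value of a logarithm atom. [folklore] -/
theorem LogAtom.val_lg (a d : ℕ) : (LogAtom.lg a d).val = Real.log ((a : ℝ) / d) := rfl

end Check


end Literature.Computability.AlgebraicComplexity
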